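import Literature.Analysis.InnerProduct.CourantFischerBounds
import Mathlib.Analysis.Calculus.MeanValue
import HarnessLib

/-!
# A chiral eigenvalue level of a symmetric pencil `T₀ − x G` must cross zero
# (or meet a non-chiral eigenvector on the way): Dini-slope form of first-order perturbation theory

Topic `Literature/Analysis/InnerProduct`. Setting: a finite-dimensional inner product space `E`
over `𝕜 = ℝ` or `ℂ`, symmetric operators `T₀` and `G` with `‖G v‖ ≤ ‖v‖` (a "grading"; in the
applications `G² = 1`), the symmetric pencil `T(x) = T₀ − x G`, and Mathlib's antitone sorted
eigenvalues `λ_i(x)` of `T(x)`.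

* `re_inner_sub_smul_sub_apply` — the quadratic form of `T(y) − T(x)` is `(x − y) re ⟪G v, v⟫`;
* `abs_eigenvalues_pencil_sub_le` — WEYL: `|λ_i(y) − λ_i(x)| ≤ |y − x|` (sorted eigenvalues are
  `1`-Lipschitz along the pencil) [Horn–Johnson Cor. 4.3.15];
* `eigenvalues_sub_smul_le` — THE DINI-SLOPE ESTIMATE (the inequality half of Kato's theorem on
  the derivatives of an eigenvalue group, *Perturbation Theory for Linear Operators* (1966),
  Thm. II.5.4 / II.6.8, proved here branch-free from the Courant–Fischer trial-subspace bound): if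
  every eigenvector of `T` with eigenvalue `λ_i(T)` has `re ⟪G v, v⟫ ≥ χ₀ ‖v‖²` (`0 < χ₀ ≤ 1`), then for
  some `γ > 0` and all `0 < ε < γ/2`, `λ_i(T − εG) ≤ λ_i(T) − ε χ₀ + ε²/(γ − 2ε)` — the level moves
  down at rate at least `χ₀`;
* `exists_pencil_eigenvalue_zero_or_nonchiral` — THE CROSSING THEOREM: if `λ_i(0) = e > 0` then there
  is `x ∈ [0, e/χ₀]` at which EITHER `T(x)` has the eigenvalue `0` (the level has crossed) OR `T(x)` has
  an eigenvector with eigenvalue in `(0, e]` whose grading form is `< χ₀ ‖v‖²` (a non-chiral — achiral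
  or oppositely graded — vector met on the way down). Proof: the sorted level `g = λ_i(·)` is
  continuous (Weyl); where its eigenspace is `χ₀`-chiral its upper-right Dini derivative is `≤ −χ₀`
  (slope estimate), so Mathlib's fencing lemma `image_le_of_liminf_slope_right_lt_deriv_boundary`
  gives `g(x) ≤ e − (χ₀ − κ)x` for every `κ > 0` unless one of the two events occurs; at `x = e/χ₀`
  this forces `g ≤ 0` and the intermediate value theorem produces the zero eigenvalue.

Motivation (crux `NestedDissectionSea.CoerciveSea`, stmt-QuantumFields-13901, line
`chirality-collapses-pseudospectrum`, stub A″): for the Hermitian Wilson cell pencil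
`H(μ) = Γ_c D_c(μ) = H(μ₀) + (μ − μ₀)Γ_c` a `χ₀`-chiral near-zero mode forces a determinant crossing
`det D_c(μ') = 0` within `|ev|/χ₀` of the valence mass unless a non-chiral window vector intervenes —
the deterministic core ("ChiralPseudomodeForcesCrossing") of the sheet-weighted Stieltjes reduction of
the A″-law. Everything here is abstract linear algebra + one-variable real analysis; no definitions.

## References

* T. Kato, *Perturbation Theory for Linear Operators*, Springer (1966), Ch. II §5.4, §6.4
  (Thm. 5.4: derivatives of the `λ`-group; Thm. 6.8: `C¹` families of symmetric operators).
* R. A. Horn, C. R. Johnson, *Matrix Analysis*, 2nd ed., CUP (2013), Thm. 4.3.1, Cor. 4.3.15. [HornJohnson2013]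
-/

noncomputable section

open scoped InnerProductSpace ComplexConjugate Topology
open Module Finset Filter Set

namespace Literature.Analysis.InnerProduct

variable {𝕜 : Type*} [RCLike 𝕜] {E : Type*} [NormedAddCommGroup E] [InnerProductSpace 𝕜 E]
  [FiniteDimensional 𝕜 E] {n : ℕ} {T₀ T G : E →ₗ[𝕜] E}

/-! ### The pencil `T₀ − x G`: quadratic form and Weyl continuity -/

omit [FiniteDimensional 𝕜 E] in
/-- The pencil `T₀ − x G` is symmetric for symmetric `T₀, G` and real `x`. [folklore] -/
theorem isSymmetric_sub_real_smul (hT₀ : T₀.IsSymmetric) (hG : G.IsSymmetric) (x : ℝ) :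
    (T₀ - ((x : ℝ) : 𝕜) • G).IsSymmetric :=
  hT₀.sub (hG.smul (RCLike.conj_ofReal x))

omit [FiniteDimensional 𝕜 E] in
/-- The quadratic form of `(T₀ − yG) − (T₀ − xG)` is `(x − y) re ⟪G v, v⟫`. [folklore] -/
theorem re_inner_sub_smul_sub_apply (x y : ℝ) (v : E) :
    RCLike.re ⟪((T₀ - ((y : ℝ) : 𝕜) • G) - (T₀ - ((x : ℝ) : 𝕜) • G)) v, v⟫_𝕜 =
      (x - y) * RCLike.re ⟪G v, v⟫_𝕜 := by
  have h : ((T₀ - ((y : ℝ) : 𝕜) • G) - (T₀ - ((x : ℝ) : 𝕜) • G)) v = (((x - y : ℝ)) : 𝕜) • G v := by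
    simp only [LinearMap.sub_apply, LinearMap.smul_apply, RCLike.ofReal_sub]
    module
  rw [h, inner_smul_left, RCLike.conj_ofReal, RCLike.re_ofReal_mul]

omit [FiniteDimensional 𝕜 E] in
/-- The grading form is bounded by the norm: `|re ⟪G v, v⟫| ≤ ‖v‖²` when `‖G v‖ ≤ ‖v‖`. [folklore] -/
theorem abs_re_inner_le_norm_sq (hGn : ∀ v : E, ‖G v‖ ≤ ‖v‖) (v : E) :
    |RCLike.re ⟪G v, v⟫_𝕜| ≤ ‖v‖ ^ 2 :=
  calc |RCLike.re ⟪G v, v⟫_𝕜| ≤ ‖⟪G v, v⟫_𝕜‖ := RCLike.abs_re_le_norm _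
    _ ≤ ‖G v‖ * ‖v‖ := norm_inner_le_norm _ _
    _ ≤ ‖v‖ * ‖v‖ := mul_le_mul_of_nonneg_right (hGn v) (norm_nonneg _)
    _ = ‖v‖ ^ 2 := (sq _).symm

/-- **Weyl continuity along the pencil.** The sorted eigenvalues of `T₀ − x G` are `1`-Lipschitz in
`x` when `‖G v‖ ≤ ‖v‖`. [cite: HornJohnson2013, Cor 4.3.15] -/
theorem abs_eigenvalues_pencil_sub_le (hT₀ : T₀.IsSymmetric) (hG : G.IsSymmetric)
    (hGn : ∀ v : E, ‖G v‖ ≤ ‖v‖) (hn : finrank 𝕜 E = n) (i : Fin n) (x y : ℝ) :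
    |(isSymmetric_sub_real_smul hT₀ hG y).eigenvalues hn i -
        (isSymmetric_sub_real_smul hT₀ hG x).eigenvalues hn i| ≤ |y - x| := by
  refine abs_eigenvalues_sub_eigenvalues_le (isSymmetric_sub_real_smul hT₀ hG x)
    (isSymmetric_sub_real_smul hT₀ hG y) hn (fun v => ?_) i
  rw [re_inner_sub_smul_sub_apply, abs_mul, abs_sub_comm]
  exact mul_le_mul_of_nonneg_left (abs_re_inner_le_norm_sq hGn v) (abs_nonneg _)

/-! ### The Dini-slope estimate: a chiral level moves down at rate `≥ χ₀` -/

/-- **Slope estimate (first-order perturbation, inequality form).** Let `T, G` be symmetric,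
`‖G v‖ ≤ ‖v‖`, `χ₀ ≤ 1`, and suppose every eigenvector `v` of `T` for the `i`-th sorted eigenvalue
`e = λ_i(T)` is `χ₀`-chiral: `χ₀ ‖v‖² ≤ re ⟪G v, v⟫`. Then there is `γ > 0` (the gap below `e` inside
the tail `λ_i ≥ λ_{i+1} ≥ ⋯`, or `1`) such that for `0 < ε`, `2ε < γ` and every symmetric `T' = T − εG`,
`λ_i(T') ≤ e − ε χ₀ + ε²/(γ − 2ε)`. Proof: Courant–Fischer with the trial space
`span {b_i, …, b_{n−1}}` of `T`; split a trial vector into its `e`-eigencomponent `y` (chiral) and the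
rest `z` (gap `γ`), and absorb the cross term `2ε‖y‖‖z‖` into `γ‖z‖²` (Kato's Thm. II.5.4 gives the
derivative exactly as the eigenvalues of `P G P`; only this one-sided bound is needed). [folklore] -/
theorem eigenvalues_sub_smul_le (hT : T.IsSymmetric) (hG : G.IsSymmetric)
    (hGn : ∀ v : E, ‖G v‖ ≤ ‖v‖) (hn : finrank 𝕜 E = n) (i : Fin n) {χ₀ : ℝ} (hχ₁ : χ₀ ≤ 1)
    (hW : ∀ v : E, T v = ((hT.eigenvalues hn i : ℝ) : 𝕜) • v →
      χ₀ * ‖v‖ ^ 2 ≤ RCLike.re ⟪G v, v⟫_𝕜) :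
    ∃ γ : ℝ, 0 < γ ∧ ∀ ε : ℝ, 0 < ε → 2 * ε < γ → ∀ {T' : E →ₗ[𝕜] E} (hT' : T'.IsSymmetric),
      T' = T - ((ε : ℝ) : 𝕜) • G →
        hT'.eigenvalues hn i ≤ hT.eigenvalues hn i - ε * χ₀ + ε ^ 2 / (γ - 2 * ε) := by
  classical
  set b := hT.eigenvectorBasis hn with hb
  set lam := hT.eigenvalues hn with hlam
  set e := lam i with he
  -- the gap below `e`
  obtain ⟨γ, hγ, hgap⟩ : ∃ γ : ℝ, 0 < γ ∧ ∀ j : Fin n, i ≤ j → lam j ≠ e → lam j ≤ e - γ := by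
    by_cases hne : (univ.filter fun j : Fin n => i ≤ j ∧ lam j ≠ e).Nonempty
    · obtain ⟨j₀, hj₀, hmax⟩ := Finset.exists_max_image _ lam hne
      have hj₀' := (Finset.mem_filter.1 hj₀).2
      have hlt : lam j₀ < e := lt_of_le_of_ne (hT.eigenvalues_antitone hn hj₀'.1) hj₀'.2
      refine ⟨e - lam j₀, by linarith, fun j hij hj => ?_⟩
      have := hmax j (Finset.mem_filter.2 ⟨Finset.mem_univ _, hij, hj⟩)
      linarith
    · refine ⟨1, one_pos, fun j hij hj => ?_⟩
      exact absurd ⟨j, Finset.mem_filter.2 ⟨Finset.mem_univ _, hij, hj⟩⟩ hne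
  refine ⟨γ, hγ, fun ε hε hεγ T' hT' hTT' => ?_⟩
  -- Courant–Fischer on the tail span of `T`
  obtain ⟨w, hwW, hw0, hCF⟩ := exists_mem_eigenvalues_mul_le_re_inner hT' hn i
    (Submodule.span 𝕜 (Set.range fun j : {j : Fin n // i ≤ j} => hT.eigenvectorBasis hn j))
    (by rw [finrank_tailSpan]; omega)
  have hc0 : ∀ j : Fin n, j < i → ⟪b j, w⟫_𝕜 = 0 :=
    fun j hj => inner_eq_zero_of_mem_tailSpan hT hn i hwW j hj
  -- coordinates and the split `w = y + z`
  set c : Fin n → 𝕜 := fun j => ⟪b j, w⟫_𝕜 with hc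
  set cy : Fin n → 𝕜 := fun j => if lam j = e then c j else 0 with hcy
  set cz : Fin n → 𝕜 := fun j => if lam j = e then 0 else c j with hcz
  set y : E := ∑ j, cy j • b j with hy
  set z : E := ∑ j, cz j • b j with hz
  have hyz : y + z = w := by
    rw [hy, hz, ← Finset.sum_add_distrib]
    conv_rhs => rw [← b.sum_repr' w]
    refine Finset.sum_congr rfl fun j _ => ?_
    rw [← add_smul]
    congr 1
    simp only [hcy, hcz]
    split_ifs <;> simp [hc]
  -- `y` is an `e`-eigenvector of `T`
  have hTy : T y = ((e : ℝ) : 𝕜) • y := by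
    rw [hy, map_sum, Finset.smul_sum]
    refine Finset.sum_congr rfl fun j _ => ?_
    rw [map_smul, hb, hT.apply_eigenvectorBasis, smul_smul, smul_smul]
    congr 1
    simp only [hcy]
    split_ifs with h
    · rw [← hlam, h, mul_comm]
    · simp
  -- norms and orthogonality in coordinates
  have hyy : ‖y‖ ^ 2 = ∑ j, ‖cy j‖ ^ 2 := by
    rw [@norm_sq_eq_re_inner 𝕜, hy, b.orthonormal.inner_sum, map_sum]
    refine Finset.sum_congr rfl fun j _ => ?_
    rw [RCLike.conj_mul, ← RCLike.ofReal_pow, RCLike.ofReal_re]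
  have hzz : ‖z‖ ^ 2 = ∑ j, ‖cz j‖ ^ 2 := by
    rw [@norm_sq_eq_re_inner 𝕜, hz, b.orthonormal.inner_sum, map_sum]
    refine Finset.sum_congr rfl fun j _ => ?_
    rw [RCLike.conj_mul, ← RCLike.ofReal_pow, RCLike.ofReal_re]
  have hyz0 : ⟪y, z⟫_𝕜 = 0 := by
    rw [hy, hz, b.orthonormal.inner_sum]
    refine Finset.sum_eq_zero fun j _ => ?_
    simp only [hcy, hcz]
    split_ifs <;> simp
  have hww : ‖w‖ ^ 2 = ‖y‖ ^ 2 + ‖z‖ ^ 2 := by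
    rw [← hyz, sq, sq, sq]
    exact norm_add_sq_eq_norm_sq_add_norm_sq_of_inner_eq_zero y z hyz0
  -- the quadratic form of `T` on `w`
  have hTw : RCLike.re ⟪T w, w⟫_𝕜 ≤ e * ‖y‖ ^ 2 + (e - γ) * ‖z‖ ^ 2 := by
    rw [re_inner_apply_self_eq_sum hT hn w, hyy, hzz, Finset.mul_sum, Finset.mul_sum,
      ← Finset.sum_add_distrib]
    refine Finset.sum_le_sum fun j _ => ?_
    simp only [hcy, hcz]
    by_cases h : lam j = e
    · simp only [h, if_true, norm_zero, ne_eq, OfNat.ofNat_ne_zero, not_false_eq_true, zero_pow,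
        mul_zero, add_zero]
      have hje : hT.eigenvalues hn j = e := h
      rw [hje]
    · simp only [h, if_false, norm_zero, ne_eq, OfNat.ofNat_ne_zero, not_false_eq_true, zero_pow,
        mul_zero, zero_add]
      by_cases hcj : c j = 0
      · have h0 : ⟪(hT.eigenvectorBasis hn) j, w⟫_𝕜 = 0 := hcj
        rw [h0, hcj]
        simp
      · have hij : i ≤ j := by
          by_contra hlt
          exact hcj (hc0 j (not_le.mp hlt))
        have := hgap j hij h
        exact mul_le_mul_of_nonneg_right this (sq_nonneg _)
  -- the grading form on `w`
  have hGw : χ₀ * ‖y‖ ^ 2 - 2 * ‖y‖ * ‖z‖ - ‖z‖ ^ 2 ≤ RCLike.re ⟪G w, w⟫_𝕜 := by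
    have hsplit : RCLike.re ⟪G w, w⟫_𝕜 =
        RCLike.re ⟪G y, y⟫_𝕜 + 2 * RCLike.re ⟪G y, z⟫_𝕜 + RCLike.re ⟪G z, z⟫_𝕜 := by
      rw [← hyz, map_add, inner_add_left, inner_add_right, inner_add_right, map_add, map_add,
        map_add]
      have : RCLike.re ⟪G z, y⟫_𝕜 = RCLike.re ⟪G y, z⟫_𝕜 := by
        rw [hG z y, ← inner_conj_symm, RCLike.conj_re]
      rw [this]
      ring
    have h1 : χ₀ * ‖y‖ ^ 2 ≤ RCLike.re ⟪G y, y⟫_𝕜 := hW y (by rw [hTy])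
    have h2 : |RCLike.re ⟪G y, z⟫_𝕜| ≤ ‖y‖ * ‖z‖ :=
      calc |RCLike.re ⟪G y, z⟫_𝕜| ≤ ‖⟪G y, z⟫_𝕜‖ := RCLike.abs_re_le_norm _
        _ ≤ ‖G y‖ * ‖z‖ := norm_inner_le_norm _ _
        _ ≤ ‖y‖ * ‖z‖ := mul_le_mul_of_nonneg_right (hGn y) (norm_nonneg _)
    have h3 : |RCLike.re ⟪G z, z⟫_𝕜| ≤ ‖z‖ ^ 2 := abs_re_inner_le_norm_sq hGn z
    rw [hsplit]
    have h2' := (abs_le.1 h2).1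
    have h3' := (abs_le.1 h3).1
    nlinarith
  -- assemble
  have hT'w : RCLike.re ⟪T' w, w⟫_𝕜 = RCLike.re ⟪T w, w⟫_𝕜 - ε * RCLike.re ⟪G w, w⟫_𝕜 := by
    rw [hTT', LinearMap.sub_apply, inner_sub_left, map_sub, LinearMap.smul_apply, inner_smul_left,
      RCLike.conj_ofReal, RCLike.re_ofReal_mul]
  have hw2 : 0 < ‖w‖ ^ 2 := by positivity
  have hγε : 0 < γ - 2 * ε := by linarith
  have key : hT'.eigenvalues hn i * ‖w‖ ^ 2 ≤
      (e - ε * χ₀ + ε ^ 2 / (γ - 2 * ε)) * ‖w‖ ^ 2 := by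
    have hsq : -(γ - 2 * ε) * ‖z‖ ^ 2 + 2 * ε * ‖y‖ * ‖z‖ ≤ ε ^ 2 / (γ - 2 * ε) * ‖y‖ ^ 2 := by
      rw [div_mul_eq_mul_div, le_div_iff₀ hγε]
      nlinarith [sq_nonneg (ε * ‖y‖ - (γ - 2 * ε) * ‖z‖)]
    have hy0 : 0 ≤ ‖y‖ := norm_nonneg _
    have hz0 : 0 ≤ ‖z‖ := norm_nonneg _
    have hdiv0 : 0 ≤ ε ^ 2 / (γ - 2 * ε) := by positivity
    calc hT'.eigenvalues hn i * ‖w‖ ^ 2 ≤ RCLike.re ⟪T' w, w⟫_𝕜 := hCF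
      _ = RCLike.re ⟪T w, w⟫_𝕜 - ε * RCLike.re ⟪G w, w⟫_𝕜 := hT'w
      _ ≤ e * ‖y‖ ^ 2 + (e - γ) * ‖z‖ ^ 2 - ε * (χ₀ * ‖y‖ ^ 2 - 2 * ‖y‖ * ‖z‖ - ‖z‖ ^ 2) := by
          nlinarith
      _ ≤ (e - ε * χ₀ + ε ^ 2 / (γ - 2 * ε)) * ‖w‖ ^ 2 := by
          rw [hww]
          nlinarith [mul_nonneg hdiv0 (sq_nonneg ‖z‖), mul_nonneg (mul_nonneg hε.le hz0) hz0,
            mul_le_mul_of_nonneg_left hχ₁ (mul_nonneg hε.le (sq_nonneg ‖z‖))]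
  exact le_of_mul_le_mul_right key hw2

/-! ### The crossing theorem -/

/-- **A chiral level crosses zero or meets a non-chiral eigenvector.** Let `T₀, G` be symmetric with
`‖G v‖ ≤ ‖v‖`, `0 < χ₀ ≤ 1`, and let the `i`-th sorted eigenvalue of `T₀ = T₀ − 0·G` be `e > 0`.
Then there is `x ∈ [0, e/χ₀]` such that EITHER `T₀ − xG` has the eigenvalue `0` (witnessed by a
non-zero kernel vector) OR `T₀ − xG` has a non-zero eigenvector `v` with eigenvalue `c ∈ (0, e]` and
grading form `re ⟪G v, v⟫ < χ₀ ‖v‖²`. Equivalently: if along `x ∈ [0, e/χ₀]` every eigenvector with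
eigenvalue in `(0, e]` is `χ₀`-chiral, the level `λ_i(x)` reaches `0` by `x = e/χ₀`. Proof: Weyl
continuity + the Dini-slope estimate `eigenvalues_sub_smul_le` fed to the fencing lemma
`image_le_of_liminf_slope_right_lt_deriv_boundary` with the lines `e − (χ₀ − κ)x`, `κ ↓ 0`, and the
intermediate value theorem. [folklore] -/
theorem exists_pencil_eigenvalue_zero_or_nonchiral (hT₀ : T₀.IsSymmetric) (hG : G.IsSymmetric)
    (hGn : ∀ v : E, ‖G v‖ ≤ ‖v‖) (hn : finrank 𝕜 E = n) (i : Fin n) {e χ₀ : ℝ} (he : 0 < e)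
    (hei : (isSymmetric_sub_real_smul hT₀ hG 0).eigenvalues hn i = e) (hχ₀ : 0 < χ₀)
    (hχ₁ : χ₀ ≤ 1) :
    ∃ x ∈ Set.Icc (0 : ℝ) (e / χ₀),
      (∃ v : E, v ≠ 0 ∧ (T₀ - ((x : ℝ) : 𝕜) • G) v = 0) ∨
      (∃ v : E, v ≠ 0 ∧ ∃ c : ℝ, (T₀ - ((x : ℝ) : 𝕜) • G) v = ((c : ℝ) : 𝕜) • v ∧ 0 < c ∧ c ≤ e ∧
        RCLike.re ⟪G v, v⟫_𝕜 < χ₀ * ‖v‖ ^ 2) := by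
  classical
  set L : ℝ := e / χ₀ with hL
  have hL0 : 0 ≤ L := by positivity
  -- the sorted level
  set g : ℝ → ℝ := fun x => (isSymmetric_sub_real_smul hT₀ hG x).eigenvalues hn i with hg
  have hg0 : g 0 = e := hei
  have hLip : ∀ x y : ℝ, |g y - g x| ≤ |y - x| := fun x y =>
    abs_eigenvalues_pencil_sub_le hT₀ hG hGn hn i x y
  have hcont : Continuous g := by
    refine (LipschitzWith.of_dist_le_mul (K := 1) fun x y => ?_).continuous
    rw [NNReal.coe_one, one_mul, Real.dist_eq, Real.dist_eq]
    exact hLip y x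
  by_contra H
  -- no kernel vector and all window eigenvectors chiral, along `[0, L]`
  have Hker : ∀ x ∈ Set.Icc (0 : ℝ) L, ∀ v : E, (T₀ - ((x : ℝ) : 𝕜) • G) v = 0 → v = 0 := by
    intro x hx v hv
    by_contra hv0
    exact H ⟨x, hx, Or.inl ⟨v, hv0, hv⟩⟩
  have Hchi : ∀ x ∈ Set.Icc (0 : ℝ) L, ∀ v : E, ∀ c : ℝ,
      (T₀ - ((x : ℝ) : 𝕜) • G) v = ((c : ℝ) : 𝕜) • v → 0 < c → c ≤ e →
        χ₀ * ‖v‖ ^ 2 ≤ RCLike.re ⟪G v, v⟫_𝕜 := by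
    intro x hx v c hv hc hce
    by_cases hv0 : v = 0
    · simp [hv0]
    by_contra hlt
    exact H ⟨x, hx, Or.inr ⟨v, hv0, c, hv, hc, hce, not_le.mp hlt⟩⟩
  -- the level never vanishes on `[0, L]`, hence stays positive (IVT)
  have hne : ∀ x ∈ Set.Icc (0 : ℝ) L, g x ≠ 0 := by
    intro x hx hgx
    have hev := (isSymmetric_sub_real_smul hT₀ hG x).hasEigenvalue_eigenvalues hn i
    obtain ⟨v, hv⟩ := hev.exists_hasEigenvector
    have hgx' : (isSymmetric_sub_real_smul hT₀ hG x).eigenvalues hn i = 0 := hgx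
    have hv1 := hv.apply_eq_smul
    rw [hgx', RCLike.ofReal_zero, zero_smul] at hv1
    exact hv.2 (Hker x hx v hv1)
  have hpos : ∀ x ∈ Set.Icc (0 : ℝ) L, 0 < g x := by
    intro x hx
    by_contra hle
    push Not at hle
    have hivt := intermediate_value_Icc' hx.1 (hcont.continuousOn (s := Set.Icc 0 x))
    have h0mem : (0 : ℝ) ∈ Set.Icc (g x) (g 0) := ⟨hle, by rw [hg0]; exact he.le⟩
    obtain ⟨x', hx', hgx'⟩ := hivt h0mem
    exact hne x' ⟨hx'.1, hx'.2.trans hx.2⟩ hgx'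
  -- fencing by the lines `e − (χ₀ − κ) x`
  have hfence : ∀ κ : ℝ, 0 < κ → κ < χ₀ → g L ≤ e - (χ₀ - κ) * L := by
    intro κ hκ hκχ
    set f' : ℝ → ℝ := fun x => if 0 < g x ∧ g x ≤ e then -χ₀ else 2 with hf'
    have hmain := image_le_of_liminf_slope_right_lt_deriv_boundary (f := g) (f' := f') (a := 0)
      (b := L) (B := fun x => e - (χ₀ - κ) * x) (B' := fun _ => -((χ₀ - κ) * 1))
      hcont.continuousOn ?_ (by simp [hg0]) ?_ ?_
    · simpa using hmain (Set.right_mem_Icc.2 hL0)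
    · -- the Dini-slope bound
      intro x hx r hr
      by_cases hw : 0 < g x ∧ g x ≤ e
      · have hr' : -χ₀ < r := by simpa [hf', hw] using hr
        have hxI : x ∈ Set.Icc (0 : ℝ) L := ⟨hx.1, hx.2.le⟩
        obtain ⟨γ, hγ, hslope⟩ := eigenvalues_sub_smul_le (isSymmetric_sub_real_smul hT₀ hG x)
          hG hGn hn i hχ₁ (fun v hv => Hchi x hxI v (g x) hv hw.1 hw.2)
        have hδ : 0 < min (γ / 4) ((r + χ₀) * γ / 4) := by
          refine lt_min (by linarith) ?_
          have : 0 < r + χ₀ := by linarith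
          positivity
        have hev : ∀ᶠ z in 𝓝[>] x, slope g x z < r := by
          filter_upwards [Ioo_mem_nhdsGT (show x < x + min (γ / 4) ((r + χ₀) * γ / 4) by linarith)]
            with z hz
          set ε := z - x with hεdef
          have hε : 0 < ε := by rw [hεdef]; linarith [hz.1]
          have hεlt : ε < min (γ / 4) ((r + χ₀) * γ / 4) := by rw [hεdef]; linarith [hz.2]
          have hε4 : ε < γ / 4 := lt_of_lt_of_le hεlt (min_le_left _ _)
          have hεr : ε < (r + χ₀) * γ / 4 := lt_of_lt_of_le hεlt (min_le_right _ _)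
          have h2ε : 2 * ε < γ := by linarith
          have hTz : T₀ - ((z : ℝ) : 𝕜) • G = (T₀ - ((x : ℝ) : 𝕜) • G) - ((ε : ℝ) : 𝕜) • G := by
            rw [hεdef, RCLike.ofReal_sub]
            module
          have hle := hslope ε hε h2ε (isSymmetric_sub_real_smul hT₀ hG z) hTz
          have hgz : g z ≤ g x - ε * χ₀ + ε ^ 2 / (γ - 2 * ε) := hle
          rw [slope_def_field]
          have hzx : 0 < z - x := hε
          rw [div_lt_iff₀ hzx, ← hεdef]
          have hγε : 0 < γ - 2 * ε := by linarith
          have hq : ε ^ 2 / (γ - 2 * ε) ≤ 2 * ε ^ 2 / γ := by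
            rw [div_le_div_iff₀ hγε hγ]
            nlinarith
          have hq2 : 2 * ε ^ 2 / γ < (r + χ₀) * ε := by
            rw [div_lt_iff₀ hγ]
            nlinarith
          nlinarith
        exact hev.frequently
      · have hr' : (2 : ℝ) < r := by simpa [hf', hw] using hr
        have hev : ∀ᶠ z in 𝓝[>] x, slope g x z < r := by
          filter_upwards [self_mem_nhdsWithin] with z hz
          rw [slope_def_field]
          have hzx : 0 < z - x := by simpa using hz
          rw [div_lt_iff₀ hzx]
          have := (abs_le.1 (hLip x z)).2
          rw [abs_of_pos hzx] at this
          nlinarith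
        exact hev.frequently
    · intro x
      simpa using ((hasDerivAt_id x).const_mul (χ₀ - κ)).const_sub e
    · -- at contact points the level is in the window, so its slope is `−χ₀ < −(χ₀ − κ)`
      intro x hx hgB
      have hxI : x ∈ Set.Icc (0 : ℝ) L := ⟨hx.1, hx.2.le⟩
      have hw : 0 < g x ∧ g x ≤ e := by
        refine ⟨hpos x hxI, ?_⟩
        rw [hgB]
        nlinarith [hx.1]
      simp only [hf', hw, and_self, if_true]
      linarith
  -- let `κ ↓ 0`
  have hgL := hpos L (Set.right_mem_Icc.2 hL0)
  set κ : ℝ := min (χ₀ / 2) (χ₀ * g L / (2 * e)) with hκ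
  have hκ0 : 0 < κ := lt_min (by linarith) (by positivity)
  have hκχ : κ < χ₀ := lt_of_le_of_lt (min_le_left _ _) (by linarith)
  have h := hfence κ hκ0 hκχ
  have hLe : (χ₀ - κ) * L = e - κ * (e / χ₀) := by
    rw [hL]
    field_simp
  rw [hLe] at h
  have hκ2 : κ * (e / χ₀) ≤ g L / 2 := by
    have hk : κ ≤ χ₀ * g L / (2 * e) := min_le_right _ _
    calc κ * (e / χ₀) ≤ χ₀ * g L / (2 * e) * (e / χ₀) :=
          mul_le_mul_of_nonneg_right hk (by positivity)
      _ = g L / 2 := by field_simp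
  linarith

end Literature.Analysis.InnerProduct

end
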